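import Mathlib
import Summits.Ventures.HodgeRepro2.T7SupportFiniteRankSelfAdjoint

/-!
# Tier7/Line3/FiniteRankAdjoint — the finite-rank formula WITHOUT self-adjointness (seat t7-L1-p4)

LINE 3 (t7-plan-3), version (ii), the two-kernel identity (memo §2e (b)–(c)). p1's row 682
`T7SupportFiniteRankSelfAdjoint.apply_eq_sum` writes a SELF-ADJOINT finite-rank operator as
`T x = ∑ i, ⟪b i, x⟫ • T (b i)` over an orthonormal basis `b` of its range, and row 692 supplies `f* = f ⇒ R(f)`
self-adjoint. crit-1's objection at STATUS l. 15122 (falsifier (α)): the model's `a_{γ₀}` rows use the TWO-vector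
coefficient `f(g) = ⟪v_A, τ(g) v_B⟫`, for which `f* ≠ f` in general, so rows 682/692 do not describe the line's `f`
as typed — the identity and the non-vanishing were proved for DIFFERENT test functions (p1's fork at l. 15134:
declare the one-vector `f`). THIS FILE removes the self-adjointness from the identity side altogether: for ANY bounded
operator `T` with finite-dimensional range and ANY orthonormal basis `b` of the range,

  `T x = ∑ i, ⟪T† (b i), x⟫ • b i`   (`apply_eq_sum_adjoint`; `T†` = `ContinuousLinearMap.adjoint T`),

because `T x` lies in the range, expands in `b`, and `⟪b i, T x⟫ = ⟪T† b i, x⟫`. Hence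
`⟪T x, y⟫ = ∑ i, conj ⟪T† b i, x⟫ · ⟪b i, y⟫` (`inner_apply_eq_sum_adjoint`): the kernel of `T` is
`∑ i, ψ i (x) · conj φ i (y)` with `ψ i = b i` (the range vectors) and `φ i = T† (b i)` (the range vectors of the
ADJOINT) — exactly the `(φ, ψ)` shape of row 686 `T7SupportFiniteRankKernel.kernel`. For the line: with `T = R(f)`,
`T† = R(f*)` (row 692 `inner_integratedForm_eq`, no symmetry needed), and `f*` is an `L¹` coefficient of the same kind
as `f` (the two-vector coefficient with the vectors swapped), so BOTH `R(f)` and `R(f*)` have continuous, finite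
range and the continuous spectral kernel exists for the two-vector `f` of the `a_{γ₀}` rows as well: the fork
«one-vector vs two-vector» is not forced by the identity. The self-adjoint case is recorded (`apply_eq_sum_of_isSelfAdjoint`).

STATUS OF RECORD (plan-3, STATUS l. 15167, memo v12 §2g, which crossed the TARGET line l. 15171 of this file): the line's
test function is DECLARED to be the one-vector coefficient at all three archimedean places, for which `f* = f` and rows
682/692 apply as typed. This file is therefore NOT load-bearing for the line as declared; it is the strict generalisation
of row 682 (self-adjointness dropped, p1's formula the special case) and records that the identity side never needed
the symmetry — the choice of `f` is governed by the `a_{γ₀}` side alone.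

Nothing here is about any group, any period, or (N); no device. No sorry; axioms ⊆ {propext, Classical.choice, Quot.sound}.
-/

namespace Summit.Ventures.HodgeRepro2.Tier7.Line3.FiniteRankAdjoint

open scoped InnerProductSpace
open Finset Summit.Ventures.HodgeRepro2.T7SupportFiniteRankSelfAdjoint

variable {H : Type*} [NormedAddCommGroup H] [InnerProductSpace ℂ H] {ι : Type*} [Fintype ι]

/-- a vector of the range expands in an orthonormal basis of the range: `u = ∑ i, ⟪b i, u⟫ • b i`. -/
theorem eq_sum_of_mem_range (T : H →L[ℂ] H) (b : OrthonormalBasis ι ℂ (range T)) {u : H}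
    (hu : u ∈ range T) : u = ∑ i, ⟪(b i : H), u⟫_ℂ • (b i : H) := by
  have hu' : (⟨u, hu⟩ : range T) = ∑ i, ⟪b i, (⟨u, hu⟩ : range T)⟫_ℂ • b i := (b.sum_repr' _).symm
  have h := congrArg (fun v : range T => (v : H)) hu'
  simp only [Submodule.coe_sum, Submodule.coe_smul, Submodule.coe_inner] at h
  exact h

/-- **the finite-rank formula without self-adjointness**: `T x = ∑ i, ⟪T† (b i), x⟫ • b i` for every bounded `T`
with finite-dimensional range and every orthonormal basis `b` of the range. -/
theorem apply_eq_sum_adjoint [CompleteSpace H] (T : H →L[ℂ] H) (b : OrthonormalBasis ι ℂ (range T))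
    (x : H) :
    T x = ∑ i, ⟪ContinuousLinearMap.adjoint T (b i : H), x⟫_ℂ • (b i : H) := by
  conv_lhs => rw [eq_sum_of_mem_range T b (apply_mem_range T x)]
  refine sum_congr rfl fun i _ => ?_
  rw [ContinuousLinearMap.adjoint_inner_left]

/-- **the bilinear form of a finite-rank operator is a finite sum, no symmetry needed**:
`⟪T x, y⟫ = ∑ i, conj ⟪T† (b i), x⟫ · ⟪b i, y⟫` — the kernel `∑ i, ψ i (x) conj φ i (y)` with `ψ i = b i` and
`φ i = T† (b i)` (the `(φ, ψ)` of row 686). -/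
theorem inner_apply_eq_sum_adjoint [CompleteSpace H] (T : H →L[ℂ] H) (b : OrthonormalBasis ι ℂ (range T))
    (x y : H) :
    ⟪T x, y⟫_ℂ = ∑ i, (starRingEnd ℂ) ⟪ContinuousLinearMap.adjoint T (b i : H), x⟫_ℂ * ⟪(b i : H), y⟫_ℂ := by
  rw [apply_eq_sum_adjoint T b x, sum_inner]
  simp only [inner_smul_left]

/-- the same with the conjugation on the other side: `⟪x, T y⟫ = ∑ i, ⟪x, b i⟫ · ⟪T† (b i), y⟫`. -/
theorem inner_apply_eq_sum_adjoint' [CompleteSpace H] (T : H →L[ℂ] H) (b : OrthonormalBasis ι ℂ (range T))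
    (x y : H) :
    ⟪x, T y⟫_ℂ = ∑ i, ⟪x, (b i : H)⟫_ℂ * ⟪ContinuousLinearMap.adjoint T (b i : H), y⟫_ℂ := by
  rw [apply_eq_sum_adjoint T b y, inner_sum]
  simp only [inner_smul_right]
  refine sum_congr rfl fun i _ => ?_
  ring

/-- the coefficient vectors `T† (b i)` lie in the range of the adjoint. -/
theorem adjoint_apply_mem_range [CompleteSpace H] (T : H →L[ℂ] H) (b : OrthonormalBasis ι ℂ (range T))
    (i : ι) : ContinuousLinearMap.adjoint T (b i : H) ∈ range (ContinuousLinearMap.adjoint T) :=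
  apply_mem_range _ _

/-- the self-adjoint case: `T x = ∑ i, ⟪T (b i), x⟫ • b i` (p1's row 682 has the same operator as
`∑ i, ⟪b i, x⟫ • T (b i)`; both are the same finite-rank operator). -/
theorem apply_eq_sum_of_isSelfAdjoint [CompleteSpace H] (T : H →L[ℂ] H) (hT : IsSelfAdjoint T)
    (b : OrthonormalBasis ι ℂ (range T)) (x : H) :
    T x = ∑ i, ⟪T (b i : H), x⟫_ℂ • (b i : H) := by
  have hadj : ContinuousLinearMap.adjoint T = T := ContinuousLinearMap.isSelfAdjoint_iff'.1 hT
  rw [apply_eq_sum_adjoint T b x, hadj]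

end Summit.Ventures.HodgeRepro2.Tier7.Line3.FiniteRankAdjoint
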